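import Literature.AnabelianGeometry.SemiGraphs.FiniteEtaleCoveringCompLocal
import Literature.AnabelianGeometry.SemiGraphs.FiniteEtaleCoveringAlignedCan
import Mathlib.Logic.Equiv.Basic

/-!
# The local description of a finite étale covering is invariant under isomorphism of the attached object ([SemiAnbd] §2, Def. 2.2 (i))

Mochizuki, *Semi-graphs of anabelioids*, Publ. RIMS **42** (2006) 221–322, §2, Definition 2.2 (i),
author's manuscript p. 23 [cite: MochizukiSemiAnbd2006, Def. 2.2(i) p.23]: the finite étale covering of
`𝒢` attached to an object `G'` of `B(𝒢)` depends on `G'` only up to isomorphism (components, component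
anabelioids and the gluing `ψ_b` are transported along an isomorphism of `B(𝒢)`).

PROOF-ONLY (abc-iut cell, layer L3, row «COMP-LOCAL»): the cell's local description
`Hom.IsFiniteEtaleCoveringOf χ B` (`Coverticial.lean`) mentions a SPECIFIC object `B`; this file records

* `componentMapIso i K` — transport of a connected component along an isomorphism of objects, a
  bijection (`componentMapIso_injective`, `componentMapIso_surjective`);
* `Hom.IsFiniteEtaleCoveringOf.congr_iso : (B ≅ B') → χ.IsFiniteEtaleCoveringOf B → χ.IsFiniteEtaleCoveringOf B'`
  (and the same for the global clause, `Hom.IsGlobalCoveringOf.congr_iso`);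
* the UNCONDITIONAL local clause of a composite with print's constructed covering:
  `Hom.IsFiniteEtaleCoveringOf.comp_coveringHomCan` — for every `χ : 𝒢 → 𝒦_A` locally attached to
  an object `B ∈ B(𝒦_A)`, the composite `χ ≫ (𝒦_A → 𝒦)` is locally attached to the object of `B(𝒦)`
  underlying `B` read in `B(𝒦)_{/A}` (`FiniteEtaleCoveringCompLocal.lean` + `FiniteEtaleCoveringAlignedCan.lean`).

No definition of a notion, no named fact; nothing here takes a side on [IUTchIII] Cor. 3.12.
-/

namespace Literature.AnabelianGeometry.SemiGraphs

open CategoryTheory CategoryTheory.Limits CategoryTheory.PreGaloisCategory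
open Literature.AnabelianGeometry.Anabelioids

universe v₁ u₁ u

-- Mathlib's `Over.pullback` / `Over.post` simp lemmas only fire under the pre-v4.2x defeq transparency
-- behaviour, exactly as in `Mathlib/CategoryTheory/Comma/Over/Pullback.lean` (also: `π₀Obj` coercions).
set_option backward.isDefEq.respectTransparency false

/-! ### Components along an isomorphism of objects -/

section MapIso

variable {C : Type u₁} [Category.{v₁} C]

/-- Transport of a connected component along an isomorphism `i : X ≅ X'`: `K ↪ X ⥲ X'`.
[cite: MochizukiSemiAnbd2006, Def. 2.2(i) p.23] -/
noncomputable def componentMapIso {X X' : C} (i : X ≅ X') (K : π₀Obj X) : π₀Obj X' :=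
  ⟨Subobject.mk (K.1.arrow ≫ i.hom),
    haveI := K.2
    isConnected_of_iso (Subobject.underlyingIso (K.1.arrow ≫ i.hom)).symm⟩

/-- The arrow of the transported component. [cite: MochizukiSemiAnbd2006, Def. 2.2(i) p.23] -/
theorem componentMapIso_arrow {X X' : C} (i : X ≅ X') (K : π₀Obj X) :
    (componentMapIso i K).1.arrow =
      (Subobject.underlyingIso (K.1.arrow ≫ i.hom)).hom ≫ K.1.arrow ≫ i.hom :=
  (Subobject.underlyingIso_hom_comp_eq_mk _).symm

/-- Transport back and forth is the identity. [cite: MochizukiSemiAnbd2006, Def. 2.2(i) p.23] -/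
theorem componentMapIso_symm_componentMapIso {X X' : C} (i : X ≅ X') (K : π₀Obj X) :
    componentMapIso i.symm (componentMapIso i K) = K := by
  apply Subtype.ext
  change Subobject.mk ((componentMapIso i K).1.arrow ≫ i.inv) = K.1
  calc Subobject.mk ((componentMapIso i K).1.arrow ≫ i.inv)
      = Subobject.mk K.1.arrow := by
        refine Subobject.mk_eq_mk_of_comm _ _ (Subobject.underlyingIso (K.1.arrow ≫ i.hom)) ?_
        rw [componentMapIso_arrow, Category.assoc, Category.assoc, Iso.hom_inv_id, Category.comp_id]
    _ = K.1 := Subobject.mk_arrow _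

/-- Transport of components along an isomorphism is injective. [cite: MochizukiSemiAnbd2006, Def. 2.2(i) p.23] -/
theorem componentMapIso_injective {X X' : C} (i : X ≅ X') : Function.Injective (componentMapIso i) := by
  intro K₁ K₂ h
  rw [← componentMapIso_symm_componentMapIso i K₁, h, componentMapIso_symm_componentMapIso]

/-- Transport of components along an isomorphism is surjective. [cite: MochizukiSemiAnbd2006, Def. 2.2(i) p.23] -/
theorem componentMapIso_surjective {X X' : C} (i : X ≅ X') : Function.Surjective (componentMapIso i) := by
  intro K'
  refine ⟨componentMapIso i.symm K', ?_⟩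
  have := componentMapIso_symm_componentMapIso i.symm K'
  rwa [Iso.symm_symm_eq] at this

end MapIso

namespace SemiGraphOfAnabelioids

variable {𝒢 ℋ 𝒦 : SemiGraphOfAnabelioids.{v₁, u₁, u}}

/-- Casting along an equality of edges commutes with transport along an isomorphism of `B(ℋ)`.
[cite: MochizukiSemiAnbd2006, Def. 2.2(i) p.23] -/
theorem BObj.castT_componentMapIso {B B' : ℋ.BObj} (e : B ≅ B') {f₁ f₂ : ℋ.graph.Edge} (h : f₁ = f₂)
    (Q : π₀Obj (B.T f₂)) :
    B'.castT h (componentMapIso ((ℋ.ρE f₂).mapIso e) Q) =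
      componentMapIso ((ℋ.ρE f₁).mapIso e) (B.castT h Q) := by
  subst h; rfl

/-- **The local description is invariant under isomorphism of the attached object**: if `χ : 𝒢 → ℋ` is,
locally, the finite étale covering attached to `B` and `B ≅ B'` in `B(ℋ)`, then `χ` is, locally, the
finite étale covering attached to `B'` (labels, component anabelioids and the branch clause transported
along the isomorphism; the gluings are intertwined by `BObj.Hom.comm`).
[cite: MochizukiSemiAnbd2006, Def. 2.2(i) p.23] -/
theorem Hom.IsFiniteEtaleCoveringOf.congr_iso {χ : Hom 𝒢 ℋ} {B B' : ℋ.BObj} (e : B ≅ B')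
    (hχ : χ.IsFiniteEtaleCoveringOf B) : χ.IsFiniteEtaleCoveringOf B' := by
  obtain ⟨hprop, cV, cE, hVb, hEb, hV, hE, hbr⟩ := hχ
  refine ⟨hprop, fun v => componentMapIso ((ℋ.ρ _).mapIso e) (cV v),
    fun e' => componentMapIso ((ℋ.ρE _).mapIso e) (cE e'), ?_, ?_, ?_, ?_, ?_⟩
  · -- vertices
    exact (Equiv.sigmaCongrRight fun w : ℋ.graph.Vertex =>
      Equiv.ofBijective (componentMapIso ((ℋ.ρ w).mapIso e))
        ⟨componentMapIso_injective _, componentMapIso_surjective _⟩).bijective.comp hVb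
  · -- edges
    exact (Equiv.sigmaCongrRight fun f : ℋ.graph.Edge =>
      Equiv.ofBijective (componentMapIso ((ℋ.ρE f).mapIso e))
        ⟨componentMapIso_injective _, componentMapIso_surjective _⟩).bijective.comp hEb
  · -- vertex constituents
    intro v
    obtain ⟨α, hα, ⟨ε⟩⟩ := hV v
    haveI := hα
    let u := Subobject.underlyingIso ((cV v).1.arrow ≫ ((ℋ.ρ (χ.base.vertexMap v)).mapIso e).hom)
    obtain ⟨σ⟩ := nonempty_starMapIso u
    refine ⟨(Over.mapIso u).functor ⋙ α, inferInstance, ⟨ε ≪≫ Functor.isoWhiskerRight σ.symm α⟩⟩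
  · -- edge constituents
    intro e'
    obtain ⟨α, hα, ⟨ε⟩⟩ := hE e'
    haveI := hα
    let u := Subobject.underlyingIso ((cE e').1.arrow ≫ ((ℋ.ρE (χ.base.edgeMap e')).mapIso e).hom)
    obtain ⟨σ⟩ := nonempty_starMapIso u
    refine ⟨(Over.mapIso u).functor ⋙ α, inferInstance, ⟨ε ≪≫ Functor.isoWhiskerRight σ.symm α⟩⟩
  · -- branches: unpack at the home edge, transport, repack
    intro b v h
    obtain ⟨t, ht⟩ := hbr b v h
    obtain ⟨t₀, ht₀⟩ := B.exists_fac_castT_of_transport (χ.base.edgeOf_branchMap b) (cE (𝒢.graph.edgeOf b))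
      _ t ht
    suffices hsuff : ∃ t' : ((B'.castT (χ.base.edgeOf_branchMap b)
        (componentMapIso ((ℋ.ρE (χ.base.edgeMap (𝒢.graph.edgeOf b))).mapIso e) (cE (𝒢.graph.edgeOf b)))).1 :
          ℋ.E (ℋ.graph.edgeOf (χ.base.branchMap b))) ⟶
        (ℋ.pull (χ.base.branchMap b) (χ.base.vertexMap v) (χ.base.abuts_branchMap b v h)).pullback.obj
          ((componentMapIso ((ℋ.ρ (χ.base.vertexMap v)).mapIso e) (cV v)).1 : ℋ.V (χ.base.vertexMap v)),
        t' ≫ (ℋ.pull (χ.base.branchMap b) (χ.base.vertexMap v) (χ.base.abuts_branchMap b v h)).pullback.map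
            (componentMapIso ((ℋ.ρ (χ.base.vertexMap v)).mapIso e) (cV v)).1.arrow ≫
          (B'.ψ (χ.base.branchMap b) (χ.base.vertexMap v) (χ.base.abuts_branchMap b v h)).hom =
        (B'.castT (χ.base.edgeOf_branchMap b)
          (componentMapIso ((ℋ.ρE (χ.base.edgeMap (𝒢.graph.edgeOf b))).mapIso e)
            (cE (𝒢.graph.edgeOf b)))).1.arrow by
      obtain ⟨t', ht'⟩ := hsuff
      exact B'.exists_transport_of_fac_castT (χ.base.edgeOf_branchMap b) _ _ t' ht'
    rw [BObj.castT_componentMapIso e]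
    refine ⟨(Subobject.underlyingIso ((B.castT (χ.base.edgeOf_branchMap b) (cE (𝒢.graph.edgeOf b))).1.arrow ≫
          ((ℋ.ρE (ℋ.graph.edgeOf (χ.base.branchMap b))).mapIso e).hom)).hom ≫ t₀ ≫
        (ℋ.pull (χ.base.branchMap b) (χ.base.vertexMap v) (χ.base.abuts_branchMap b v h)).pullback.map
          (Subobject.underlyingIso ((cV v).1.arrow ≫ ((ℋ.ρ (χ.base.vertexMap v)).mapIso e).hom)).inv, ?_⟩
    have hc := e.hom.comm (χ.base.branchMap b) (χ.base.vertexMap v) (χ.base.abuts_branchMap b v h)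
    rw [componentMapIso_arrow, componentMapIso_arrow]
    simp only [Category.assoc]
    rw [← Functor.map_comp_assoc, Iso.inv_hom_id_assoc, Functor.map_comp_assoc]
    change _ ≫ t₀ ≫ _ ≫ (ℋ.pull _ _ _).pullback.map (e.hom.fS _) ≫ _ =
      _ ≫ (B.castT (χ.base.edgeOf_branchMap b) (cE (𝒢.graph.edgeOf b))).1.arrow ≫ e.hom.fT _
    rw [hc, reassoc_of% ht₀]

/-- The GLOBAL clause `B(𝒢) ≃ B(ℋ)_{/B}` is likewise invariant under isomorphism of `B` (transport
through `Over.mapIso`). [cite: MochizukiSemiAnbd2006, Def. 2.2(i) p.23] -/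
theorem Hom.IsGlobalCoveringOf.congr_iso {χ : Hom 𝒢 ℋ} {B B' : ℋ.BObj} (e : B ≅ B')
    (hχ : χ.IsGlobalCoveringOf B) : χ.IsGlobalCoveringOf B' := by
  obtain ⟨inst, α, hα, ⟨η⟩⟩ := hχ
  letI := inst
  haveI := hα
  obtain ⟨σ⟩ := nonempty_starMapIso e
  refine ⟨inst, (Over.mapIso e).inverse ⋙ α, inferInstance, ⟨η ≪≫ Functor.isoWhiskerRight
    ((Over.star B).rightUnitor.symm ≪≫ Functor.isoWhiskerLeft (Over.star B) (Over.mapIso e).unitIso ≪≫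
      Functor.isoWhiskerRight σ (Over.mapIso e).inverse) α⟩⟩

/-- **The local clause of a composite with print's constructed covering, unconditionally**: for every
`χ : 𝒢 → 𝒦_A` which is, locally, the finite étale covering attached to an object `B` of `B(𝒦_A)`, the
composite `χ ≫ (𝒦_A → 𝒦)` is, locally, the finite étale covering of `𝒦` attached to the object underlying
`B` read in `B(𝒦)_{/A}` through the comparison `B(𝒦_A) ≃ B(𝒦)_{/A}` ([SemiAnbd] p. 23: a finite étale
covering of `B(𝒢)_{G'}` "may also be regarded as a finite étale covering of `B(𝒢)`").
[cite: MochizukiSemiAnbd2006, Def. 2.2(i) p.23] -/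
theorem Hom.IsFiniteEtaleCoveringOf.comp_coveringHomCan (A : 𝒦.BObj) {χ : Hom 𝒢 A.coveringGraph}
    {B : A.coveringGraph.BObj} (hχ : χ.IsFiniteEtaleCoveringOf B) :
    haveI := A.alignedLocalDataCan_lift_isEquivalence
    (χ.comp A.coveringHomCan).IsFiniteEtaleCoveringOf ((A.alignedLocalDataCan).lift.inv.obj B).left := by
  haveI := A.alignedLocalDataCan_lift_isEquivalence
  exact Hom.IsFiniteEtaleCoveringOf.comp_of_alignedLocalData (A.alignedLocalDataCan)
    ((A.alignedLocalDataCan).lift.inv.obj B) A.fibreData.isProper_proj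
    (hχ.congr_iso ((A.alignedLocalDataCan).lift.asEquivalence.counitIso.app B).symm)

end SemiGraphOfAnabelioids

end Literature.AnabelianGeometry.SemiGraphs
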